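import Summits.BirchSwinnertonDyer.Rank1Residual.Additive.CyclotomicTowerSignedSelmer
import Summits.BirchSwinnertonDyer.Rank1Residual.AdditivePotMult.TwistDescent
import HarnessLib

/-!
# `Sel^ε(E/K_∞)^η` sits inside the classical Selmer group of `K₀·K_∞` and — for `η` the quadratic
# character of `K₀` — inside additive-p1's `χ`-eigen Selmer group `chiEigenSelmer`
# (cell `b2b-bsdres`, CLASS-CLOSURE lane, seat cc-typer-6 GEN 8; comparison API of the (B′) OBJECT,
# `cells/n1011/skel/T-O7ss-P13-DISCHARGE-SCOPING.md` §3 (D2)/(D3) hooks — FILE 4, theorems only)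

HONEST FRAMING (cell `b2b-bsdres`, run/shared/lean/b2b/bsd-rank1-residual/, verbatim in every
file): the goal of the cell is to DELETE the COMBINATION-SHAPED residual classes of the
Birch–Swinnerton-Dyer formula for ALL analytic-rank `≤ 1` elliptic curves over `ℚ` — "full BSD
formula for every rank `≤ 1` curve in class `C`" assembled STRICTLY from published theorems — so
that the rank-`≤ 1` remainder becomes exactly the CONSTRUCTION-SHAPED classes, which are TYPED
(missing-input `Prop`s), NOT attempted. This is not "finishing BSD". CLASS-CLOSURE lane: prove
what is provable now; shrink each hard class to its core with data; no claim beyond stated classes;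
research routes; census output = EVIDENCE / conjecture items, never a Literature fact;
RESIDUAL-MAP marks change only by signed lines. O7-ss stays OPEN, X4 CONSTRUCTION-SHAPED; nothing
here is booked; no label moves. THEOREMS ONLY (inclusions between already-defined subgroups); no
definition, no named Literature fact, no `sorry`; nothing of Kobayashi's theorems is asserted.

## Contents

* `towerTopSubgroup_eq`: `towerTopSubgroup κ K₀ = ker κ ⊓ galRange K₀` (definitional) — the ambient
  group `H¹(ker κ ⊓ Gal(K̄/K₀), E[p^∞])` of FILE 2 IS the ambient group of additive-p1's
  `AdditivePotMult.chiEigenSelmer` (`TwistDescent.lean`) for `K₀` the quadratic field: the two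
  vocabularies need no transport between them.
* `towerSignedSelmerInfty_le_selmerGroupOver`, `towerSignedSelmerInftyEta_le_selmerGroupOver`:
  `Sel^ε(E/K_∞) ≤ Sel_{p^∞}(E/K₀·K_∞)` and the same for the `η`-part (restriction carries the layer
  Selmer groups into the Selmer group of the top field, `resOfLe_mem_selmerGroupOver`) — the
  classical half of the dictionary's (D2)/(D4, ℓ ≠ p).
* `towerSignedSelmerInftyEta_le_chiEigenSelmer` (`K = ℚ`): if `η` agrees with the quadratic
  character `quadSign K₀` of `K₀` on `ker κ`, then `Sel^ε(E/K₀·ℚ_∞)^η ≤ Sel_{p^∞}(E/K₀·ℚ_∞)^{(χ_{K₀})}`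
  — the signed `η`-part is a subgroup of the `χ`-eigen Selmer group that `twistDescentEquiv`
  identifies with `Sel_{p^∞}(E ⊗ χ/ℚ_∞)`; the (D3) sign bookkeeping at the level of inclusions. The
  local computation at `p` ((D4 at p): which subgroup of `Sel_{p^∞}(E ⊗ χ/ℚ_∞)` the signed part IS)
  is n1011-p17's (P5) and is NOT here.

References: [Kobayashi2003] Def. 2.1 (p. 5), §4 p. 8; [GreenbergLNM1716] §1 Thm. 1.2 (restriction
maps), §5 p. 143; [Dokchitser2013ParityNotes] §4 (the sign rule).
-/

noncomputable section

open scoped Classical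

universe u

namespace Summit.BirchSwinnertonDyer.Rank1Residual.Additive

open Literature.NumberTheory.EllipticCurves Literature.NumberTheory.GaloisRepresentations
  Literature.NumberTheory.EllipticCurves.Kobayashi2003 ZpExtension

/-! ## §1 Inside the classical Selmer group of the top field -/

section General

variable {K : Type u} [Field K] [NumberField K] (W : WeierstrassCurve K) {p : ℕ} [Fact p.Prime]
  (κ : ZpExtension K p) (K₀ : Type u) [Field K₀] [NumberField K₀] [Algebra K K₀]
  (E : Type u) [Field E] [Algebra K E] [(galRange (K := K) K₀).Normal]

omit [NumberField K] [NumberField K₀] [(galRange (K := K) K₀).Normal] in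
/-- The ambient subgroup of FILE 2 is `ker κ ⊓ Gal(K̄/K₀)` on the nose (definitional) — the SAME
subgroup additive-p1's `chiEigenSelmer` lives over. [folklore] -/
theorem towerTopSubgroup_eq : towerTopSubgroup κ K₀ = κ.kerSubgroup ⊓ galRange (K := K) K₀ :=
  rfl

/-- **`Sel^ε(E/K_∞) ≤ Sel_{p^∞}(E/K₀·K_∞)`**: every image of `Sel^ε(E/K_n) ≤ Sel_{p^∞}(E/K_n)` under
restriction lands in the classical Selmer group of the top field (`resOfLe_mem_selmerGroupOver`,
Greenberg's restriction maps `s_n`). [cite: Kobayashi2003, Def. 2.1 (p. 5)]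
[cite: GreenbergLNM1716, §1 Thm. 1.2] -/
theorem towerSignedSelmerInfty_le_selmerGroupOver (ε : ℤˣ) :
    towerSignedSelmerInfty W κ K₀ E ε ≤ W.selmerGroupOver p (towerTopSubgroup κ K₀) :=
  iSup_le fun n ↦ by
    rintro _ ⟨c, hc, rfl⟩
    exact W.resOfLe_mem_selmerGroupOver p (towerTopSubgroup_le κ K₀ n)
      (towerSignedSelmerLayer_le_selmerGroupOver W κ K₀ E ε n hc)

/-- **`Sel^ε(E/K_∞)^η ≤ Sel_{p^∞}(E/K₀·K_∞)`**. [cite: Kobayashi2003, Def. 2.1 (p. 5) and §4 p. 8] -/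
theorem towerSignedSelmerInftyEta_le_selmerGroupOver (η : Field.absoluteGaloisGroup K →* ℤˣ)
    (ε : ℤˣ) :
    towerSignedSelmerInftyEta W κ K₀ E η ε ≤ W.selmerGroupOver p (towerTopSubgroup κ K₀) :=
  (towerSignedSelmerInftyEta_le W κ K₀ E η ε).trans
    (towerSignedSelmerInfty_le_selmerGroupOver W κ K₀ E ε)

end General

/-! ## §2 `K = ℚ`: inside additive-p1's `χ`-eigen Selmer group -/

section Rational

-- NOTE: no `[Algebra ℚ K₀]` binder here — over `ℚ` the cell's convention (additive-p1's
-- `TwistDescent`) is Mathlib's canonical `algebraRat` instance coming with `[NumberField K₀]`; a second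
-- `Algebra ℚ K₀` variable would make `galRange K₀` (hence `chiEigenSelmer`) live over a different
-- (non-defeq) instance.
variable (W : WeierstrassCurve ℚ) {p : ℕ} [Fact p.Prime] (κ : ZpExtension ℚ p)
  (K₀ : Type) [Field K₀] [NumberField K₀] (E : Type) [Field E] [Algebra ℚ E]
  [(galRange (K := ℚ) K₀).Normal] (η : Field.absoluteGaloisGroup ℚ →* ℤˣ) (ε : ℤˣ)

/-- **`Sel^ε(E/K₀·ℚ_∞)^η ≤ Sel_{p^∞}(E/K₀·ℚ_∞)^{(χ_{K₀})}`** when `η` IS the quadratic character of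
`K₀` on `ker κ` (`(η σ : ℤ) = quadSign K₀ σ`, i.e. `η σ = 1 ↔ σ ∈ Gal(ℚ̄/K₀)`): the signed `η`-part
(Kobayashi's `ε_η`-component of the signed Selmer group over `K₀·ℚ_∞`, FILE 2) is a subgroup of
additive-p1's `chiEigenSelmer W K₀ p κ` — the `χ_{K₀}`-eigenspace of the CLASSICAL Selmer group of
`K₀·ℚ_∞`, which `AdditivePotMult.twistDescentEquiv` identifies with `Sel_{p^∞}(E ⊗ χ_{K₀}/ℚ_∞)`
(Greenberg LNM 1716 p. 143 prime-to-`p` descent + the sign rule). For `K₀ = ℚ(√p*)`, `p` odd: the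
odd-branch `η = ω^{(p−1)/2}` restricted to `ℚ_∞(√p*)`. The identification of WHICH subgroup (the local
condition at `p`, (D4)) is not made here. [cite: Kobayashi2003, §4 p. 8 (M^η = ε_η M)]
[cite: GreenbergLNM1716, §5 p. 143] [cite: Dokchitser2013ParityNotes, §4] -/
theorem towerSignedSelmerInftyEta_le_chiEigenSelmer
    (hη : ∀ σ ∈ κ.kerSubgroup, ((η σ : ℤˣ) : ℤ) = AdditivePotMult.quadSign K₀ σ) :
    towerSignedSelmerInftyEta W κ K₀ E η ε ≤ AdditivePotMult.chiEigenSelmer W K₀ p κ := by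
  intro s hs
  refine ⟨towerSignedSelmerInftyEta_le_selmerGroupOver W κ K₀ E η ε hs, fun g ↦ ?_⟩
  rw [← hη g g.2]
  exact hs.2 g g.2

omit [(galRange (K := ℚ) K₀).Normal] in
/-- The hypothesis of `towerSignedSelmerInftyEta_le_chiEigenSelmer` in closed form: `η` agrees with
`quadSign K₀` on `ker κ` as soon as `η σ = 1 ↔ σ ∈ Gal(ℚ̄/K₀)` for `σ ∈ ker κ` (a `ℤˣ`-valued character
takes the values `±1` only). [folklore] -/
theorem coe_eta_eq_quadSign_of_iff {σ : Field.absoluteGaloisGroup ℚ}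
    (h : η σ = 1 ↔ σ ∈ galRange (K := ℚ) K₀) :
    ((η σ : ℤˣ) : ℤ) = AdditivePotMult.quadSign K₀ σ := by
  by_cases hσ : σ ∈ galRange (K := ℚ) K₀
  · rw [AdditivePotMult.quadSign_of_mem K₀ hσ, h.mpr hσ, Units.val_one]
  · rw [AdditivePotMult.quadSign_of_not_mem K₀ hσ]
    rcases Int.units_eq_one_or (η σ) with h1 | h1
    · exact absurd (h.mp h1) hσ
    · rw [h1, Units.val_neg, Units.val_one]

end Rational

end Summit.BirchSwinnertonDyer.Rank1Residual.Additive

end
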